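import Summits.KontsevichZagierPeriods.KontsevichZagierPeriods.Theorems.UnfoldedStokesStokesGenerationStubGermToOan
import Mathlib.RingTheory.MvPowerSeries.Substitution
import Mathlib.RingTheory.Algebraic.Integral
import Mathlib.RingTheory.IntegralClosure.IsIntegralClosure.Basic
import Mathlib.FieldTheory.AlgebraicClosure
import Mathlib.Algebra.MvPolynomial.Variables

/-!
# `StokesGeneration` (stmt-KontsevichZagierPeriods-3586), line `Sketch`, stub `stub_spanToReps` — part 4:
the rational polynomial identity satisfied by the sum of an element of `𝒪_{ℚ̄-alg}(𝔻̄^∞)`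

Support file for the registered stub `stub_spanToReps` (dictionary, folding half) of the crux
`StokesGeneration` (route UnfoldedStokes, line `Sketch` = card cube-type-a-generation), on top of
`Literature/NumberTheory/Transcendental/AyoubPeriodSeries.lean` (`AyoubRel.IsAlgebraicOverRatFunc`,
`AyoubRel.polyToCSeries`, `AyoubRel.DependsOnlyOnLT`).

* DESCENT TO `ℚ` (`exists_rat_polynomial_smul`): a series of `ℂ[[z₀, z₁, …]]` algebraic over
  `ℚ̄(z)` (`ℚ̄ = algebraicClosure ℚ ℂ`) is algebraic over `ℚ(z)`, and so are its `ℚ̄`-multiples: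
  `ℚ̄[z]` is integral over `ℚ[z]` (Mathlib: push-out of the integral extension `ℚ̄/ℚ`) and
  algebraicity descends along integral extensions of domains (`IsAlgebraic.restrictScalars`).
* VARIABLES: the coefficients of a polynomial `P ∈ ℚ[z][Y]` involve finitely many variables
  (`exists_vars_subset_range`); when they all lie among `z₀, …, z_{M-1}`, the polynomial
  `Q = P` read in `ℚ[x₁, …, x_M][Y]` (`MvPolynomial.killCompl`) is non-zero of the same degree, and
  its coefficients evaluate at `x ∈ ℝᴹ` as those of `P` at the attached point of `ℂ^ℕ`
  (`eval_pt_map_eq_aeval_killCompl`).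
* THE IDENTITY (`polynomial_identity_of_eval₂_eq_zero`, `exists_polynomial_identity_fin`): if
  `P(K) = 0` in `ℂ[[z]]` for a series `K` in the variables `z₀, …, z_{M-1}` with
  `Σ_b ‖K_b‖ r^{|b|} < ∞`, then the sum `k(x) = Σₐ κ(a) xᵃ` satisfies `Σₙ qₙ(x) k(x)ⁿ = 0` for every
  real `x` with `|xⱼ| ≤ r` (rescale by `r`, Mathlib's `MvPowerSeries.rescale`, then evaluate on the
  closed unit polydisc, where evaluation of absolutely summable series is a ring homomorphism — part 2
  of `stub_germToOan`).

This is the algebraic input of the folding half of the dictionary between Ayoub's series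
`𝒪_{ℚ̄-alg}(𝔻̄^∞)` and real functions near the closed unit cube (J. Ayoub, EMS Newsl. 91 (2014) §2.2,
Def. 9, Rem. 13). No definition is introduced.
-/

noncomputable section

-- `Summit.KontsevichZagierPeriods.KontsevichZagierPeriods.…` is the tree's mandated layout (single-conjunct summit).
set_option linter.dupNamespace false

namespace Summit.KontsevichZagierPeriods.KontsevichZagierPeriods.StokesGenerationLine

open Finsupp MvPowerSeries
open Literature.NumberTheory.Transcendental
open Literature.NumberTheory.Transcendental.AyoubRel

/-! ## Descent of algebraicity from `ℚ̄(z)` to `ℚ(z)` -/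

section Descent

/-- `ℚ̄[z] → ℂ[[z]]` (resp. `k[z] → ℂ[[z]]`) along the inclusion is Mathlib's algebra map.
[folklore] -/
theorem polyToCSeries_eq_algebraMap {k : Type} [Field k] [Algebra k ℂ] :
    polyToCSeries (algebraMap k ℂ) = algebraMap (MvPolynomial ℕ k) CSeries := by
  refine MvPolynomial.ringHom_ext (fun c => ?_) (fun i => ?_)
  · simp [polyToCSeries, MvPowerSeries.algebraMap_apply']
  · simp [polyToCSeries, MvPowerSeries.algebraMap_apply']

/-- **Descent to `ℚ`.** If `G ∈ ℂ[[z₀, z₁, …]]` is algebraic over `ℚ̄(z)` (`ℚ̄ = algebraicClosure ℚ ℂ`)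
then every multiple `λ G`, `λ ∈ ℚ̄`, is algebraic over `ℚ(z)`: some non-zero `P ∈ ℚ[z][Y]` has
`P(λ G) = 0` (`ℚ̄[z]` is integral over `ℚ[z]`, and algebraicity descends along integral extensions of
domains). [cite: Ayoub2014, Def. 9] -/
theorem exists_rat_polynomial_smul {G : CSeries}
    (hG : IsAlgebraicOverRatFunc (algebraMap (algebraicClosure ℚ ℂ) ℂ) G)
    (lam : algebraicClosure ℚ ℂ) :
    ∃ P : Polynomial (MvPolynomial ℕ ℚ), P ≠ 0 ∧
      Polynomial.eval₂ (polyToCSeries (algebraMap ℚ ℂ))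
        ((algebraMap (algebraicClosure ℚ ℂ) ℂ lam) • G) P = 0 := by
  letI : Algebra (MvPolynomial ℕ ℚ) (MvPolynomial ℕ (algebraicClosure ℚ ℂ)) :=
    MvPolynomial.algebraMvPolynomial
  haveI : Algebra.IsAlgebraic ℚ (algebraicClosure ℚ ℂ) := algebraicClosure.isAlgebraic ℚ ℂ
  haveI : IsScalarTower (MvPolynomial ℕ ℚ) (MvPolynomial ℕ (algebraicClosure ℚ ℂ)) CSeries := by
    refine IsScalarTower.of_algebraMap_eq' ?_
    refine MvPolynomial.ringHom_ext (fun c => ?_) (fun i => ?_)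
    · simp [MvPowerSeries.algebraMap_apply']
    · simp [MvPowerSeries.algebraMap_apply']
  have h1 : IsAlgebraic (MvPolynomial ℕ (algebraicClosure ℚ ℂ)) G := by
    obtain ⟨P, hP, h0⟩ := hG
    exact ⟨P, hP, by rwa [Polynomial.aeval_def, ← polyToCSeries_eq_algebraMap]⟩
  have h2 : IsAlgebraic (MvPolynomial ℕ (algebraicClosure ℚ ℂ))
      ((MvPolynomial.C lam : MvPolynomial ℕ (algebraicClosure ℚ ℂ)) • G) := h1.smul _
  have hsmul : (MvPolynomial.C lam : MvPolynomial ℕ (algebraicClosure ℚ ℂ)) • G =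
      (algebraMap (algebraicClosure ℚ ℂ) ℂ lam) • G := by
    rw [Algebra.smul_def, MvPowerSeries.algebraMap_apply', MvPolynomial.coe_C, MvPowerSeries.map_C,
      ← MvPowerSeries.smul_eq_C_mul]
  rw [hsmul] at h2
  have h3 : IsAlgebraic (MvPolynomial ℕ ℚ) ((algebraMap (algebraicClosure ℚ ℂ) ℂ lam) • G) :=
    h2.restrictScalars _
  obtain ⟨P, hP, h0⟩ := h3
  exact ⟨P, hP, by rwa [Polynomial.aeval_def, ← polyToCSeries_eq_algebraMap] at h0⟩

end Descent

/-! ## Variables of the coefficients; passing to `ℚ[x₁, …, x_M]` -/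

section Variables

/-- The coefficients of `P ∈ ℚ[z][Y]` involve only finitely many variables: for all large `M`,
all of them lie among `z₀, …, z_{M-1}`. [folklore] -/
theorem exists_vars_subset_range (P : Polynomial (MvPolynomial ℕ ℚ)) :
    ∃ V : ℕ, ∀ M : ℕ, V ≤ M → ∀ n : ℕ,
      (↑(P.coeff n).vars : Set ℕ) ⊆ Set.range (Fin.val : Fin M → ℕ) := by
  classical
  refine ⟨(P.support.biUnion fun n => (P.coeff n).vars).sup id + 1, fun M hM n i hi => ?_⟩
  have hn : n ∈ P.support := by
    rw [Polynomial.mem_support_iff]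
    intro h0
    rw [Finset.mem_coe, h0, MvPolynomial.vars_0] at hi
    simp at hi
  have hle : i ≤ (P.support.biUnion fun n => (P.coeff n).vars).sup id :=
    Finset.le_sup (f := id) (Finset.mem_biUnion.mpr ⟨n, hn, hi⟩)
  exact ⟨⟨i, by omega⟩, rfl⟩

/-- **Reading a coefficient in `ℚ[x₁, …, x_M]`.** If the variables of `p ∈ ℚ[z₀, z₁, …]` lie among
`z₀, …, z_{M-1}`, then `p`, pushed to `ℂ[z]` and evaluated at the point of `ℂ^ℕ` attached to
`x ∈ ℝᴹ`, is the value at `x` of `p` read in `ℚ[x₁, …, x_M]` (`MvPolynomial.killCompl`).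
[folklore] -/
theorem eval_pt_map_eq_aeval_killCompl {M : ℕ} (p : MvPolynomial ℕ ℚ)
    (hp : (↑p.vars : Set ℕ) ⊆ Set.range (Fin.val : Fin M → ℕ)) (x : Fin M → ℝ) :
    MvPolynomial.eval (fun i : ℕ => if hi : i < M then ((x ⟨i, hi⟩ : ℝ) : ℂ) else 0)
        (MvPolynomial.map (algebraMap ℚ ℂ) p) =
      ((MvPolynomial.aeval x
        (MvPolynomial.killCompl (Fin.val_injective : Function.Injective (Fin.val : Fin M → ℕ)) p) :
          ℝ) : ℂ) := by
  obtain ⟨q, rfl⟩ := MvPolynomial.exists_rename_eq_of_vars_subset_range p Fin.val Fin.val_injective hp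
  rw [MvPolynomial.killCompl_rename_app, MvPolynomial.map_rename, MvPolynomial.eval_rename,
    MvPolynomial.eval_map, ofReal_aeval_eq]
  congr 1
  funext j
  simp only [Function.comp_apply, dif_pos j.is_lt, Fin.eta]

/-- **`P` read in `ℚ[x₁, …, x_M][Y]` is non-zero of the same degree** when all the variables of the
coefficients of `0 ≠ P ∈ ℚ[z][Y]` lie among `z₀, …, z_{M-1}`. [folklore] -/
theorem map_killCompl_ne_zero {M : ℕ} {P : Polynomial (MvPolynomial ℕ ℚ)} (hP : P ≠ 0)
    (hvars : ∀ n, (↑(P.coeff n).vars : Set ℕ) ⊆ Set.range (Fin.val : Fin M → ℕ)) :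
    P.map (MvPolynomial.killCompl
        (Fin.val_injective : Function.Injective (Fin.val : Fin M → ℕ))).toRingHom ≠ 0 ∧
      (P.map (MvPolynomial.killCompl
        (Fin.val_injective : Function.Injective (Fin.val : Fin M → ℕ))).toRingHom).natDegree =
        P.natDegree := by
  have hlc : (MvPolynomial.killCompl
      (Fin.val_injective : Function.Injective (Fin.val : Fin M → ℕ))).toRingHom
        (P.coeff P.natDegree) ≠ 0 := by
    obtain ⟨q, hq⟩ := MvPolynomial.exists_rename_eq_of_vars_subset_range (P.coeff P.natDegree)
      Fin.val Fin.val_injective (hvars P.natDegree)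
    rw [← hq, AlgHom.toRingHom_eq_coe, RingHom.coe_coe, MvPolynomial.killCompl_rename_app]
    intro h0
    apply Polynomial.leadingCoeff_ne_zero.mpr hP
    show P.coeff P.natDegree = 0
    rw [← hq, h0, map_zero]
  refine ⟨fun h => hlc ?_, Polynomial.natDegree_map_of_leadingCoeff_ne_zero _ hlc⟩
  have := congrArg (fun Q : Polynomial (MvPolynomial (Fin M) ℚ) => Q.coeff P.natDegree) h
  simpa only [Polynomial.coeff_map, Polynomial.coeff_zero] using this

end Variables

/-! ## Rescaling and the polynomial identity for the sum -/

section Identity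

/-- The value at `x ∈ ℝᴹ` of a series in the variables `z₀, …, z_{M-1}`, re-indexed by
`Fin M →₀ ℕ` (local copy of the re-indexing lemma of part 3). [folklore] -/
theorem tsum_coeff_mul_prod_pow_eq_tsum_fin' {M : ℕ} {S : CSeries} (hS : DependsOnlyOnLT S M)
    (x : Fin M → ℝ) :
    ∑' b : ℕ →₀ ℕ, coeff b S *
        b.prod (fun i e => (fun i : ℕ => if hi : i < M then ((x ⟨i, hi⟩ : ℝ) : ℂ) else 0) i ^ e) =
      ∑' a : Fin M →₀ ℕ, coeff (Finsupp.embDomain Fin.valEmbedding a) S *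
        ∏ j, ((x j : ℝ) : ℂ) ^ (a j) := by
  have hinj := Finsupp.embDomain_injective (M := ℕ) (Fin.valEmbedding (n := M))
  have hsupp : Function.support (fun b : ℕ →₀ ℕ => coeff b S *
      b.prod (fun i e => (fun i : ℕ => if hi : i < M then ((x ⟨i, hi⟩ : ℝ) : ℂ) else 0) i ^ e)) ⊆
      Set.range (Finsupp.embDomain (M := ℕ) (Fin.valEmbedding (n := M))) := by
    intro b hb
    by_contra hb'
    apply hb
    show coeff b S * _ = 0
    rw [hS b (exists_of_not_mem_range_embDomain hb'), zero_mul]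
  calc ∑' b : ℕ →₀ ℕ, coeff b S *
        b.prod (fun i e => (fun i : ℕ => if hi : i < M then ((x ⟨i, hi⟩ : ℝ) : ℂ) else 0) i ^ e)
      = ∑' a : Fin M →₀ ℕ, coeff (Finsupp.embDomain Fin.valEmbedding a) S *
          (Finsupp.embDomain Fin.valEmbedding a).prod
            (fun i e => (fun i : ℕ => if hi : i < M then ((x ⟨i, hi⟩ : ℝ) : ℂ) else 0) i ^ e) :=
        (hinj.tsum_eq hsupp).symm
    _ = _ := tsum_congr fun a => by rw [prod_pow_embDomain_cubePt]

/-- Evaluating the rescaled series `K(r z)` at `y` is evaluating `K` at `r y` (termwise).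
[folklore] -/
theorem tsum_coeff_rescale_mul_prod_pow (S : CSeries) (r : ℂ) (y : ℕ → ℂ) :
    ∑' b : ℕ →₀ ℕ, coeff b (MvPowerSeries.rescale (fun _ : ℕ => r) S) *
        b.prod (fun i e => y i ^ e) =
      ∑' b : ℕ →₀ ℕ, coeff b S * b.prod (fun i e => (r * y i) ^ e) := by
  refine tsum_congr fun b => ?_
  rw [MvPowerSeries.coeff_rescale, mul_comm _ (coeff b S), mul_assoc, ← Finsupp.prod_mul]
  simp only [mul_pow]

/-- `∏ᵢ r^{bᵢ} = r^{|b|}`. [folklore] -/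
theorem prod_const_pow_eq (b : ℕ →₀ ℕ) (r : ℂ) : (b.prod fun _ m => r ^ m) = r ^ degree b := by
  rw [Finsupp.prod, Finset.prod_pow_eq_pow_sum, Finsupp.degree_apply]

/-- The rescaled series `K(r z)` has absolutely summable coefficients when
`Σ_b ‖K_b‖ r^{|b|} < ∞`. [folklore] -/
theorem summable_norm_coeff_rescale {S : CSeries} {r : ℝ} (hr : 0 ≤ r)
    (hs : Summable fun b : ℕ →₀ ℕ => ‖coeff b S‖ * r ^ degree b) :
    Summable fun b : ℕ →₀ ℕ => ‖coeff b (MvPowerSeries.rescale (fun _ : ℕ => (r : ℂ)) S)‖ := by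
  refine hs.congr fun b => ?_
  rw [MvPowerSeries.coeff_rescale, prod_const_pow_eq, norm_mul, norm_pow, Complex.norm_real,
    Real.norm_of_nonneg hr, mul_comm]

/-- A rescaled polynomial has (finitely many, hence) absolutely summable coefficients.
[folklore] -/
theorem summable_norm_coeff_rescale_coe (q : MvPolynomial ℕ ℂ) (a : ℕ → ℂ) :
    Summable fun b : ℕ →₀ ℕ => ‖coeff b (MvPowerSeries.rescale a (q : CSeries))‖ := by
  refine summable_of_ne_finset_zero (s := q.support) fun b hb => ?_
  rw [MvPowerSeries.coeff_rescale, MvPolynomial.coeff_coe, MvPolynomial.notMem_support_iff.mp hb,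
    mul_zero, norm_zero]

/-- **The polynomial identity for the sum.** If `P(K) = 0` in `ℂ[[z]]` (`P ∈ ℚ[z][Y]`) for a series
`K` in the variables `z₀, …, z_{M-1}` with `Σ_b ‖K_b‖ r^{|b|} < ∞`, then at every real `x` with
`|xⱼ| ≤ r` the sum `k(x) = Σₐ κ(a) xᵃ` satisfies `Σₙ pₙ(x) k(x)ⁿ = 0` (rescale by `r` — a ring
endomorphism of `ℂ[[z]]` —, then evaluate on the closed unit polydisc, where evaluation of
absolutely summable series is a ring homomorphism). [cite: Ayoub2014, Def. 9 and Rem. 13] -/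
theorem polynomial_identity_of_eval₂_eq_zero {M : ℕ} {K : CSeries} {r : ℝ} (hr : 0 < r)
    (hK : Summable fun b : ℕ →₀ ℕ => ‖coeff b K‖ * r ^ degree b) (hKd : DependsOnlyOnLT K M)
    (P : Polynomial (MvPolynomial ℕ ℚ))
    (hP : Polynomial.eval₂ (polyToCSeries (algebraMap ℚ ℂ)) K P = 0)
    (x : Fin M → ℝ) (hx : ∀ j, |x j| ≤ r) :
    ∑ n ∈ Finset.range (P.natDegree + 1),
      MvPolynomial.eval (fun i : ℕ => if hi : i < M then ((x ⟨i, hi⟩ : ℝ) : ℂ) else 0)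
          (MvPolynomial.map (algebraMap ℚ ℂ) (P.coeff n)) *
        (∑' a : Fin M →₀ ℕ, coeff (Finsupp.embDomain Fin.valEmbedding a) K *
          ∏ j, ((x j : ℝ) : ℂ) ^ (a j)) ^ n = 0 := by
  set pt : ℕ → ℂ := fun i => if hi : i < M then ((x ⟨i, hi⟩ : ℝ) : ℂ) else 0 with hpt
  set y : ℕ → ℂ := fun i => pt i / r with hy_def
  set Rs : CSeries →+* CSeries := MvPowerSeries.rescale (fun _ : ℕ => (r : ℂ)) with hRs
  set ψ : MvPolynomial ℕ ℚ →+* CSeries := polyToCSeries (algebraMap ℚ ℂ) with hψ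
  have hψapp : ∀ p : MvPolynomial ℕ ℚ,
      ψ p = ((MvPolynomial.map (algebraMap ℚ ℂ) p : MvPolynomial ℕ ℂ) : CSeries) := fun p => by
    simp only [hψ, polyToCSeries, RingHom.comp_apply, MvPolynomial.coeToMvPowerSeries.ringHom_apply]
  have hpt_le : ∀ i, ‖pt i‖ ≤ r := by
    intro i
    simp only [hpt]
    split_ifs with hi
    · rw [Complex.norm_real, Real.norm_eq_abs]; exact hx _
    · rw [norm_zero]; exact hr.le
  have hy : ∀ i, ‖y i‖ ≤ 1 := fun i => by
    simp only [hy_def]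
    rw [norm_div, Complex.norm_real, Real.norm_of_nonneg hr.le, div_le_one hr]
    exact hpt_le i
  have hry : ∀ i, (r : ℂ) * y i = pt i := fun i => by
    simp only [hy_def]
    rw [mul_div_cancel₀ _ (Complex.ofReal_ne_zero.mpr hr.ne')]
  -- apply the ring endomorphism `Rs` to the identity and expand
  have h1 : Polynomial.eval₂ (Rs.comp ψ) (Rs K) P = 0 := by
    rw [← Polynomial.hom_eval₂, hP, map_zero]
  rw [Polynomial.eval₂_eq_sum_range] at h1
  -- summability of the coefficients of the pieces
  have hRK : Summable fun b : ℕ →₀ ℕ => ‖coeff b (Rs K)‖ := summable_norm_coeff_rescale hr.le hK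
  have hcoef : ∀ n, Summable fun b : ℕ →₀ ℕ => ‖coeff b ((Rs.comp ψ) (P.coeff n))‖ := fun n => by
    rw [RingHom.comp_apply, hψapp]
    exact summable_norm_coeff_rescale_coe _ _
  -- evaluate at `y`
  have h2 := congrArg (fun S : CSeries => ∑' b : ℕ →₀ ℕ, coeff b S * b.prod (fun i e => y i ^ e)) h1
  simp only [map_zero, zero_mul, tsum_zero] at h2
  rw [tsum_coeff_sum_mul_prod_pow hy _ _ (fun n _ =>
    summable_norm_coeff_mul (hcoef n) (summable_norm_coeff_pow hRK n))] at h2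
  have hterm : ∀ n ∈ Finset.range (P.natDegree + 1),
      ∑' b : ℕ →₀ ℕ, coeff b ((Rs.comp ψ) (P.coeff n) * Rs K ^ n) * b.prod (fun i e => y i ^ e) =
        MvPolynomial.eval pt (MvPolynomial.map (algebraMap ℚ ℂ) (P.coeff n)) *
          (∑' a : Fin M →₀ ℕ, coeff (Finsupp.embDomain Fin.valEmbedding a) K *
            ∏ j, ((x j : ℝ) : ℂ) ^ (a j)) ^ n := by
    intro n _
    rw [tsum_coeff_mul_mul_prod_pow hy (hcoef n) (summable_norm_coeff_pow hRK n),
      tsum_coeff_pow_mul_prod_pow hy hRK]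
    congr 1
    · rw [RingHom.comp_apply, hRs, tsum_coeff_rescale_mul_prod_pow]
      simp only [hry]
      rw [hψapp]
      exact tsum_coeff_coe_mul_prod_pow pt _
    · congr 1
      rw [hRs, tsum_coeff_rescale_mul_prod_pow]
      simp only [hry]
      exact tsum_coeff_mul_prod_pow_eq_tsum_fin' hKd x
  rw [Finset.sum_congr rfl hterm] at h2
  exact h2

/-- **The rational polynomial identity in `M` real variables.** Under the hypotheses of
`polynomial_identity_of_eval₂_eq_zero`, if moreover `P ≠ 0` and all the variables of its
coefficients lie among `z₀, …, z_{M-1}`, there is a non-zero `Q ∈ ℚ[x₁, …, x_M][Y]` with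
`Σₙ Qₙ(x) k(x)ⁿ = 0` for all real `x` with `|xⱼ| ≤ r`. [cite: Ayoub2014, Def. 9 and Rem. 13] -/
theorem exists_polynomial_identity_fin {M : ℕ} {K : CSeries} {r : ℝ} (hr : 0 < r)
    (hK : Summable fun b : ℕ →₀ ℕ => ‖coeff b K‖ * r ^ degree b) (hKd : DependsOnlyOnLT K M)
    (P : Polynomial (MvPolynomial ℕ ℚ)) (hP0 : P ≠ 0)
    (hP : Polynomial.eval₂ (polyToCSeries (algebraMap ℚ ℂ)) K P = 0)
    (hvars : ∀ n, (↑(P.coeff n).vars : Set ℕ) ⊆ Set.range (Fin.val : Fin M → ℕ)) :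
    ∃ Q : Polynomial (MvPolynomial (Fin M) ℚ), Q ≠ 0 ∧
      ∀ x : Fin M → ℝ, (∀ j, |x j| ≤ r) →
        ∑ n ∈ Finset.range (Q.natDegree + 1), ((MvPolynomial.aeval x (Q.coeff n) : ℝ) : ℂ) *
          (∑' a : Fin M →₀ ℕ, coeff (Finsupp.embDomain Fin.valEmbedding a) K *
            ∏ j, ((x j : ℝ) : ℂ) ^ (a j)) ^ n = 0 := by
  obtain ⟨hQ0, hdeg⟩ := map_killCompl_ne_zero hP0 hvars
  refine ⟨P.map (MvPolynomial.killCompl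
    (Fin.val_injective : Function.Injective (Fin.val : Fin M → ℕ))).toRingHom, hQ0, fun x hx => ?_⟩
  rw [hdeg, ← polynomial_identity_of_eval₂_eq_zero hr hK hKd P hP x hx]
  refine Finset.sum_congr rfl fun n _ => ?_
  rw [Polynomial.coeff_map, eval_pt_map_eq_aeval_killCompl (P.coeff n) (hvars n) x]
  rfl

end Identity

/-! ## The complex series of the germ evaluated on a bigger cube; weighted families re-indexed -/

section Germ

/-- The monomial of an exponent pushed forward from `Fin N`, at the point of `ℂ^ℕ` attached to
`x ∈ ℝᴹ` (`N ≤ M`), is `∏ⱼ x_{j}^{aⱼ}` over the first `N` coordinates. [folklore] -/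
theorem prod_pow_embDomain_pt_castLE {N M : ℕ} (hNM : N ≤ M) (x : Fin M → ℝ) (a : Fin N →₀ ℕ) :
    (Finsupp.embDomain Fin.valEmbedding a).prod
        (fun i e => (fun i : ℕ => if hi : i < M then ((x ⟨i, hi⟩ : ℝ) : ℂ) else 0) i ^ e) =
      ∏ j, ((x (Fin.castLE hNM j) : ℝ) : ℂ) ^ (a j) := by
  rw [Finsupp.prod_embDomain, Finsupp.prod_fintype _ _ (fun j => pow_zero _)]
  refine Finset.prod_congr rfl fun j _ => ?_
  simp only [Fin.valEmbedding_apply, dif_pos (j.is_lt.trans_le hNM)]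
  rfl

/-- **The complex series of the germ evaluated on the bigger cube**: if `coeff F` is `cₐ` at the
exponents pushed forward from `Fin N` and `0` elsewhere, and `Σₐ cₐ (pr x)ᵃ = s` for `x ∈ ℝᴹ`
(`pr` = first `N` coordinates), then `F` evaluated at the point attached to `x` is `s`.
[cite: Ayoub2014, Rem. 13] -/
theorem hasSum_coeff_mul_prod_pow_castLE {N M : ℕ} (hNM : N ≤ M) {c : (Fin N →₀ ℕ) → ℝ}
    {F : CSeries}
    (hFc : ∀ a : Fin N →₀ ℕ, coeff (a.embDomain Fin.valEmbedding) F = (c a : ℂ))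
    (hFz : ∀ b : ℕ →₀ ℕ, b ∉ Set.range (Finsupp.embDomain (@Fin.valEmbedding N)) → coeff b F = 0)
    (x : Fin M → ℝ) {s : ℝ}
    (hs : HasSum (fun a : Fin N →₀ ℕ => c a * ∏ j, x (Fin.castLE hNM j) ^ a j) s) :
    HasSum (fun b : ℕ →₀ ℕ => coeff b F *
      b.prod (fun i e => (fun i : ℕ => if hi : i < M then ((x ⟨i, hi⟩ : ℝ) : ℂ) else 0) i ^ e))
      (s : ℂ) := by
  have hinj := Finsupp.embDomain_injective (M := ℕ) (Fin.valEmbedding (n := N))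
  refine (hinj.hasSum_iff fun b hb => by rw [hFz b hb, zero_mul]).1 ?_
  · have hs' : HasSum (fun a : Fin N →₀ ℕ => ((c a * ∏ j, x (Fin.castLE hNM j) ^ a j : ℝ) : ℂ))
        (s : ℂ) := Complex.hasSum_ofReal.2 hs
    convert hs' using 1
    funext a
    simp only [Function.comp_apply]
    rw [hFc a, prod_pow_embDomain_pt_castLE hNM]
    push_cast
    rfl

/-- Weighted coefficient families re-indexed by `Fin M →₀ ℕ` stay summable. [folklore] -/
theorem summable_weighted_fin {M : ℕ} {S : CSeries} {r : ℝ}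
    (hs : Summable fun b : ℕ →₀ ℕ => ‖coeff b S‖ * r ^ degree b) :
    Summable fun a : Fin M →₀ ℕ =>
      ‖coeff (Finsupp.embDomain Fin.valEmbedding a) S‖ * r ^ a.degree :=
  (hs.comp_injective (Finsupp.embDomain_injective (M := ℕ) (Fin.valEmbedding (n := M)))).congr
    fun a => by simp only [Function.comp_apply, degree_embDomain_valEmbedding]

/-- … and so do their real parts. [folklore] -/
theorem summable_abs_re_weighted {ι : Type*} {κ : ι → ℂ} {w : ι → ℝ} (hw : ∀ a, 0 ≤ w a)
    (hs : Summable fun a => ‖κ a‖ * w a) : Summable fun a => |(κ a).re| * w a :=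
  hs.of_nonneg_of_le (fun a => mul_nonneg (abs_nonneg _) (hw a)) fun a =>
    mul_le_mul_of_nonneg_right (Complex.abs_re_le_norm _) (hw a)

end Germ

/-! ## Registered form -/

/-- **Registered auxiliary stub** `stub_spanToRepsAuxAlg` (sub-goal of `stub_spanToReps`, crux
stmt-KontsevichZagierPeriods-3586): the sum of a series of `ℂ[[z₀, z₁, …]]` in the variables
`z₀, …, z_{M-1}` with `Σ_b ‖K_b‖ r^{|b|} < ∞` that is a root of a non-zero `P ∈ ℚ[z][Y]` whose
coefficients involve only `z₀, …, z_{M-1}` satisfies a non-trivial polynomial identity with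
coefficients in `ℚ[x₁, …, x_M]` at every real point of the closed box of radius `r`
(= `exists_polynomial_identity_fin`). [cite: Ayoub2014, Def. 9 and Rem. 13] -/
theorem stub_spanToRepsAuxAlg :
    ∀ (M : ℕ) (K : MvPowerSeries ℕ ℂ) (r : ℝ) (P : Polynomial (MvPolynomial ℕ ℚ)), 0 < r →
      Summable (fun b : ℕ →₀ ℕ => ‖MvPowerSeries.coeff b K‖ * r ^ b.degree) →
      AyoubRel.DependsOnlyOnLT K M → P ≠ 0 →
      Polynomial.eval₂ (AyoubRel.polyToCSeries (algebraMap ℚ ℂ)) K P = 0 →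
      (∀ n, (↑(P.coeff n).vars : Set ℕ) ⊆ Set.range (Fin.val : Fin M → ℕ)) →
      ∃ Q : Polynomial (MvPolynomial (Fin M) ℚ), Q ≠ 0 ∧
        ∀ x : Fin M → ℝ, (∀ j, |x j| ≤ r) →
          ∑ n ∈ Finset.range (Q.natDegree + 1), ((MvPolynomial.aeval x (Q.coeff n) : ℝ) : ℂ) *
            (∑' a : Fin M →₀ ℕ, MvPowerSeries.coeff (Finsupp.embDomain Fin.valEmbedding a) K *
              ∏ j, ((x j : ℝ) : ℂ) ^ (a j)) ^ n = 0 :=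
  fun _ _ _ P hr hK hKd hP0 hP hvars => exists_polynomial_identity_fin hr hK hKd P hP0 hP hvars

end Summit.KontsevichZagierPeriods.KontsevichZagierPeriods.StokesGenerationLine
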